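import Summits.SmoothPoincare4.SmoothPoincare4.Theses.DottedCircleRasmussen
import Summits.SmoothPoincare4.SmoothPoincare4.Theorems.DottedCircleRasmussenDcrGfgmw
import Literature.Topology.FourManifolds.MMSWRasmussenFactsProofs
import Literature.Topology.FourManifolds.HomotopyBallSliceProofs
import Literature.Topology.FourManifolds.DehnSurgeryTubularNbhdProofs

/-!
# `DcrGap` — negative-side support II: the `k = 0` layer of the crux is the FGMW question

Support lemmas for the crux `Summit.SmoothPoincare4.SmoothPoincare4.Theses.DottedCircleRasmussen.DcrGap`
(stmt-SmoothPoincare4-16128, the ONE-HANDLE SLICE GAP of route `DottedCircleRasmussen`), from the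
standing disprover's work file `Cruxes/DcrGap/Disproof.lean` §4; companion of `NoDiscNormalForm.lean`
(theorems only; nothing here concludes the crux or any route item positively).

HARDNESS PIN.  With no dotted circle (`k = 0`) the model handlebody `D_0 = {G_0 ≤ 1}` is the solid
ellipsoid `L(B̄⁴)` for the scaling `L = diag(40, 40, 1, 1)` of `ℝ⁴` (`exists_scaling`,
`levelFun_zero_scaling`: `G_0(L y) = ‖y‖²`), and a knot `K : S¹ ↪ S³` rescaled onto `∂D_0` by such
an `L` is a model knot (`isModelKnot_scaling_comp`).  Under this dictionary the tree's H-slice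
predicate `Knot.IsSliceDiscIn K X e f` (a slice disc in `X ∖ e(B̊⁴)`, `HomotopyBallSlice.lean`) and
the crux's slice datum `MMSW.IsSliceDiscInComplement 0 (L ∘ K) X · f` correspond exactly
(`isSliceDiscInComplement_zero_of_isSliceDiscIn`, `isSliceDiscIn_of_isSliceDiscInComplement_zero`;
the chart changes by `L`).  Consequently

* `isSmoothlySlice_of_isHomotopyBallSlice_of_not_dcrGap` — **if the crux FAILS, every knot that is
  slice in a homotopy 4-ball is slice in `B⁴`**: `¬ DcrGap` makes the no-disc clause fail for the
  rescaled knot; the resulting datum in some `N ≅ S⁴` is standardised (Palais,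
  `DcrGfgmw.exists_isModelSliceDisc_or_mirror_of_diffeomorph`, mirror absorbed by `ρ ∘ ρ = id` —
  the normal form `Negative.noDisc_iff_forall_not_isModelSliceDisc` of `NoDiscNormalForm.lean`) to
  a MODEL slice disc, which a stereographic push, Palais' ball-complement theorem and neatening
  (tree: `MMSW.IsModelSliceDisc.isSliceDiscInComplement_chartAt_symm`,
  `Knot.palais_ballComplement_sphere_four_holds`, `Knot.isSmoothlySlice_of_isProperDisc_holds`)
  turn into a slice disc in `B⁴`;
* `not_fgmw_of_not_dcrGap` — so a refutation of the crux refutes the whole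
  Freedman–Gompf–Morrison–Walker / Manolescu–Piccirillo strategy ("some knot is slice in a
  homotopy 4-ball but not in `B⁴`"; MMSW Question 9.11 asks for exactly such a rigidity at `k = 0`
  and is open).  Read contrapositively, any FGMW certificate proves the crux at `k = 0`; the
  `k ≥ 1` layers are the route's surplus over FGMW.

So `¬ DcrGap` sits between `SmoothPoincare4` (which implies it: `closes`) and the negation of the
FGMW gap (which it implies): no refutation of the crux is cheaper than a rigidity theorem for slice
discs in ALL homotopy 4-balls.

References: M. Freedman, R. Gompf, S. Morrison, K. Walker, *Man and machine thinking about the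
smooth 4-dimensional Poincaré conjecture*, Quantum Topol. 1 (2010), §1
[FreedmanGompfMorrisonWalker2010]; C. Manolescu, L. Piccirillo, J. Lond. Math. Soc. 108 (2023),
Def. 2.1 [ManolescuPiccirillo2023]; C. Manolescu, M. Marengon, S. Sarkar, M. Willis, Duke Math. J.
172 (2023), Question 9.11 [ManolescuMarengonSarkarWillis2023]; R. Palais, Proc. AMS 11 (1960),
Thm. B [Palais1960].
-/

noncomputable section

-- The namespace is prescribed by the crux protocol (`Summit.<P>.<Sub>.Theorems.<Crux>.Negative`
-- with `P = Sub = SmoothPoincare4`), hence the duplicated component.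
set_option linter.dupNamespace false

open scoped Manifold ContDiff Topology
open Function Set
open Literature.Topology.FourManifolds Literature.Topology.FourManifolds.MMSW
open Summit.SmoothPoincare4.SmoothPoincare4.Theses.DottedCircleRasmussen

namespace Summit.SmoothPoincare4.SmoothPoincare4.Theorems.DcrGap.Negative

/-! ## The `k = 0` model is the solid ellipsoid `L(B̄⁴)`, `L = diag(40, 40, 1, 1)` -/

/-- **The scaling `L = diag(40, 40, 1, 1)` exists** as a continuous linear automorphism of `ℝ⁴`
(stated through its four coordinate identities, which is all that is used below). [folklore] -/
theorem exists_scaling :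
    ∃ L : EuclideanSpace ℝ (Fin 4) ≃L[ℝ] EuclideanSpace ℝ (Fin 4),
      ∀ x, L x 0 = 40 * x 0 ∧ L x 1 = 40 * x 1 ∧ L x 2 = x 2 ∧ L x 3 = x 3 := by
  refine ⟨LinearEquiv.toContinuousLinearEquiv
    { toFun := fun x => !₂[40 * x 0, 40 * x 1, x 2, x 3]
      map_add' := fun x y => by
        ext i; fin_cases i <;> simp [mul_add]
      map_smul' := fun c x => by
        ext i; fin_cases i <;> simp [mul_left_comm]
      invFun := fun x => !₂[x 0 / 40, x 1 / 40, x 2, x 3]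
      left_inv := fun x => by
        ext i; fin_cases i <;> simp
      right_inv := fun x => by
        ext i; fin_cases i <;> simp [mul_div_cancel₀] }, fun x => ⟨?_, ?_, ?_, ?_⟩⟩ <;>
  simp

section Scaling

variable {L : EuclideanSpace ℝ (Fin 4) ≃L[ℝ] EuclideanSpace ℝ (Fin 4)}
  (hL : ∀ x, L x 0 = 40 * x 0 ∧ L x 1 = 40 * x 1 ∧ L x 2 = x 2 ∧ L x 3 = x 3)
include hL

/-- `G_0(L y) = ‖y‖²` for the scaling `L`. [folklore] -/
theorem levelFun_zero_scaling (y : EuclideanSpace ℝ (Fin 4)) : levelFun 0 (L y) = ‖y‖ ^ 2 := by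
  obtain ⟨h0, h1, h2, h3⟩ := hL y
  rw [EuclideanSpace.norm_sq_eq]
  simp only [levelFun, Finset.univ_eq_empty, Finset.sum_empty, add_zero, Nat.cast_zero, zero_add,
    mul_one, h0, h1, h2, h3, Real.norm_eq_abs, sq_abs, Fin.sum_univ_four]
  ring

/-- `L y ∈ D_0 ↔ ‖y‖ ≤ 1`: the `k = 0` model handlebody is the solid ellipsoid `L(B̄⁴)`. [folklore] -/
theorem scaling_mem_modelHandlebody_zero_iff (y : EuclideanSpace ℝ (Fin 4)) :
    L y ∈ modelHandlebody 0 ↔ ‖y‖ ≤ 1 := by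
  rw [mem_modelHandlebody_iff, levelFun_zero_scaling hL]
  simp only [IsEmpty.forall_iff, true_and]
  exact sq_le_one_iff₀ (norm_nonneg y)

/-- `L y ∈ ∂D_0 ↔ ‖y‖ = 1`: the `k = 0` model boundary is the ellipsoid `L(S³)`. [folklore] -/
theorem scaling_mem_modelBoundary_zero_iff (y : EuclideanSpace ℝ (Fin 4)) :
    L y ∈ modelBoundary 0 ↔ ‖y‖ = 1 := by
  rw [mem_modelBoundary_iff, levelFun_zero_scaling hL]
  simp only [IsEmpty.forall_iff, true_and]
  exact pow_eq_one_iff_of_nonneg (norm_nonneg y) two_ne_zero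

/-- `D_0 = L(B̄⁴)`. [folklore] -/
theorem image_scaling_closedBall :
    (L : EuclideanSpace ℝ (Fin 4) → EuclideanSpace ℝ (Fin 4)) ''
        Metric.closedBall (0 : EuclideanSpace ℝ (Fin 4)) 1 = modelHandlebody 0 := by
  ext x
  constructor
  · rintro ⟨y, hy, rfl⟩
    exact (scaling_mem_modelHandlebody_zero_iff hL y).2 (mem_closedBall_zero_iff.1 hy)
  · intro hx
    refine ⟨L.symm x, ?_, L.apply_symm_apply x⟩
    rw [mem_closedBall_zero_iff, ← scaling_mem_modelHandlebody_zero_iff hL, L.apply_symm_apply]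
    exact hx

/-! ## A knot `K ⊂ S³`, rescaled onto `∂D_0`, is a model knot -/

/-- **A knot in `S³`, rescaled onto `∂D_0` by `L`, is a model knot** (`MMSW.IsModelKnot 0`):
smooth, injective, immersed (chain rule with the linear automorphism `L`), on the level set
`G_0 = 1`. [folklore] -/
theorem isModelKnot_scaling_comp (K : Knot) :
    IsModelKnot 0 ((L : EuclideanSpace ℝ (Fin 4) → EuclideanSpace ℝ (Fin 4)) ∘ fun t =>
      ((K t : Metric.sphere (0 : EuclideanSpace ℝ (Fin 4)) 1) : EuclideanSpace ℝ (Fin 4))) := by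
  have hLs : ContMDiff 𝓘(ℝ, EuclideanSpace ℝ (Fin 4)) 𝓘(ℝ, EuclideanSpace ℝ (Fin 4)) ∞
      (L : EuclideanSpace ℝ (Fin 4) → EuclideanSpace ℝ (Fin 4)) :=
    (L : EuclideanSpace ℝ (Fin 4) →L[ℝ] EuclideanSpace ℝ (Fin 4)).contDiff.contMDiff
  refine ⟨hLs.comp K.contMDiff_coe_comp,
    L.injective.comp (Subtype.val_injective.comp K.injective), fun t => ?_,
    fun t => (scaling_mem_modelBoundary_zero_iff hL _).2 (norm_eq_of_mem_sphere (K t))⟩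
  have h1 : MDifferentiableAt 𝓘(ℝ, EuclideanSpace ℝ (Fin 4)) 𝓘(ℝ, EuclideanSpace ℝ (Fin 4))
      (L : EuclideanSpace ℝ (Fin 4) → EuclideanSpace ℝ (Fin 4))
      ((K t : Metric.sphere (0 : EuclideanSpace ℝ (Fin 4)) 1) : EuclideanSpace ℝ (Fin 4)) :=
    hLs.mdifferentiableAt (by simp)
  have h2 : MDifferentiableAt (𝓡 1) 𝓘(ℝ, EuclideanSpace ℝ (Fin 4))
      (fun t => ((K t : Metric.sphere (0 : EuclideanSpace ℝ (Fin 4)) 1) : EuclideanSpace ℝ (Fin 4)))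
      t :=
    K.contMDiff_coe_comp.mdifferentiableAt (by simp)
  rw [mfderiv_comp t h1 h2, mfderiv_eq_fderiv, L.fderiv]
  exact L.injective.comp (K.mfderiv_coe_comp_injective t)

/-! ## Bridge between the two disc predicates at `k = 0` -/

omit hL in
/-- **H-slice data are `k = 0` dotted-slice data.** For any linear automorphism `L` with
`L(B̄⁴) = D_0`, a slice disc for `K` in `X ∖ e(B̊⁴)` (`Knot.IsSliceDiscIn K X e f`) is a slice
datum for the rescaled knot `L ∘ K` in the complement of the `k = 0` model handlebody, with chart
`e ∘ L⁻¹`. [folklore] -/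
theorem isSliceDiscInComplement_zero_of_isSliceDiscIn
    (hD : ∀ y, L y ∈ modelHandlebody 0 ↔ ‖y‖ ≤ 1) {X : Type*} [TopologicalSpace X]
    [ChartedSpace (EuclideanSpace ℝ (Fin 4)) X] [IsManifold (𝓡 4) ∞ X] {K : Knot}
    {e : EuclideanSpace ℝ (Fin 4) → X} {f : EuclideanSpace ℝ (Fin 2) → X}
    (h : K.IsSliceDiscIn X e f) :
    IsSliceDiscInComplement 0
      ((L : EuclideanSpace ℝ (Fin 4) → EuclideanSpace ℝ (Fin 4)) ∘ fun t =>
        ((K t : Metric.sphere (0 : EuclideanSpace ℝ (Fin 4)) 1) : EuclideanSpace ℝ (Fin 4)))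
      X (e ∘ (L.symm : EuclideanSpace ℝ (Fin 4) → EuclideanSpace ℝ (Fin 4))) f := by
  obtain ⟨he, hf, hinj, hmf, hout, hb⟩ := h
  refine ⟨?_, hf, hinj, hmf, fun x hx hmem => ?_, fun t => ?_⟩
  · simpa using he.comp_diffeomorph L.symm.toDiffeomorph
  · obtain ⟨y, hy, hyx⟩ := hmem
    refine hout x hx ⟨L.symm y, ?_, hyx⟩
    have h' := hD (L.symm y)
    rw [L.apply_symm_apply] at h'
    exact mem_closedBall_zero_iff.2 (h'.1 hy)
  · simp only [Function.comp_apply, ContinuousLinearEquiv.symm_apply_apply]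
    exact hb t

omit hL in
/-- **`k = 0` dotted-slice data are H-slice data.** Conversely a slice datum for the rescaled
knot `L ∘ K` in the complement of `e(D_0)` is a slice disc for `K` in `X ∖ (e ∘ L)(B̊⁴)`.
[folklore] -/
theorem isSliceDiscIn_of_isSliceDiscInComplement_zero
    (hD : ∀ y, L y ∈ modelHandlebody 0 ↔ ‖y‖ ≤ 1) {X : Type*} [TopologicalSpace X]
    [ChartedSpace (EuclideanSpace ℝ (Fin 4)) X] [IsManifold (𝓡 4) ∞ X] {K : Knot}
    {e : EuclideanSpace ℝ (Fin 4) → X} {f : EuclideanSpace ℝ (Fin 2) → X}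
    (h : IsSliceDiscInComplement 0
      ((L : EuclideanSpace ℝ (Fin 4) → EuclideanSpace ℝ (Fin 4)) ∘ fun t =>
        ((K t : Metric.sphere (0 : EuclideanSpace ℝ (Fin 4)) 1) : EuclideanSpace ℝ (Fin 4))) X e f) :
    K.IsSliceDiscIn X (e ∘ (L : EuclideanSpace ℝ (Fin 4) → EuclideanSpace ℝ (Fin 4))) f := by
  obtain ⟨he, hf, hinj, hmf, hout, hb⟩ := h
  refine ⟨?_, hf, hinj, hmf, fun x hx hmem => ?_, fun t => hb t⟩
  · simpa using he.comp_diffeomorph L.toDiffeomorph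
  · obtain ⟨y, hy, hyx⟩ := hmem
    exact hout x hx ⟨L y, (hD y).2 (mem_closedBall_zero_iff.1 hy), hyx⟩

end Scaling

/-! ## The hardness pin -/

/-- **`¬ DcrGap` settles the FGMW question**: if the crux fails, EVERY knot that is slice in a
homotopy 4-ball is slice in `B⁴` — i.e. the Freedman–Gompf–Morrison–Walker / Manolescu–Piccirillo
strategy against SPC4 is void (MMSW Question 9.11 at `k = 0`).  Proof: an H-slice datum for `K`
in a homotopy sphere `M` is a `k = 0` dotted-slice datum for the rescaled knot `L ∘ K ⊂ ∂D_0`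
(`isSliceDiscInComplement_zero_of_isSliceDiscIn`); `¬ DcrGap` makes the no-disc clause fail for
it, and the datum so obtained in some `N ≅ S⁴` is standardised (Palais) to a MODEL slice disc for
`L ∘ K` in `ℝ⁴ ∖ D_0`; pushed into `S⁴` along a stereographic chart and un-scaled it is a slice
disc for `K` in `S⁴ ∖ σ⁻¹L(B̊⁴)` (`isSliceDiscIn_of_isSliceDiscInComplement_zero`), which Palais'
ball-complement theorem and neatening (`Knot.palais_ballComplement_sphere_four_holds`,
`Knot.isSmoothlySlice_of_isProperDisc_holds`) turn into a slice disc in `B⁴`.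
[cite: FreedmanGompfMorrisonWalker2010, §1] [cite: Palais1960, Thm. B] -/
theorem isSmoothlySlice_of_isHomotopyBallSlice_of_not_dcrGap (hX : ¬ DcrGap) (K : Knot)
    (hK : K.IsHomotopyBallSlice) : K.IsSmoothlySlice := by
  obtain ⟨L, hL⟩ := exists_scaling
  have hD := scaling_mem_modelHandlebody_zero_iff hL
  set K' : Metric.sphere (0 : EuclideanSpace ℝ (Fin 2)) 1 → EuclideanSpace ℝ (Fin 4) :=
    (L : EuclideanSpace ℝ (Fin 4) → EuclideanSpace ℝ (Fin 4)) ∘ fun t =>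
      ((K t : Metric.sphere (0 : EuclideanSpace ℝ (Fin 4)) 1) : EuclideanSpace ℝ (Fin 4)) with hK'
  obtain ⟨M, _, _, _, _, _, _, hM, e, f, hef⟩ := hK
  have hmk : IsModelKnot 0 K' := isModelKnot_scaling_comp hL K
  have hdat : IsSliceDiscInComplement 0 K' M _ f := isSliceDiscInComplement_zero_of_isSliceDiscIn hD hef
  -- `¬ DcrGap`: the no-disc clause FAILS for the rescaled knot, i.e. some `N ≅ S⁴` carries a datum
  have hno : ¬ ∀ (N : Type) [TopologicalSpace N] [T2Space N] [SecondCountableTopology N]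
      [ChartedSpace (EuclideanSpace ℝ (Fin 4)) N] [IsManifold (𝓡 4) ∞ N],
      Nonempty (N ≃ₘ⟮𝓡 4, 𝓡 4⟯ (Metric.sphere (0 : EuclideanSpace ℝ (Fin 5)) 1)) →
        ∀ (e' : EuclideanSpace ℝ (Fin 4) → N) (f' : EuclideanSpace ℝ (Fin 2) → N),
          ¬ IsSliceDiscInComplement 0 K' N e' f' :=
    fun h => hX ⟨0, K', hmk, ⟨M, _, ‹_›, ‹_›, _, ‹_›, hM, _, f, hdat⟩, h⟩
  simp only [not_forall, not_not] at hno
  obtain ⟨N, _, _, _, _, _, ⟨Θ⟩, e', f', hd⟩ := hno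
  -- standardise it (Palais, `DcrGfgmw.exists_isModelSliceDisc_or_mirror_of_diffeomorph`) to a
  -- MODEL slice disc for the rescaled knot, the mirror being absorbed by `ρ ∘ ρ = id`
  -- (this is `Negative.noDisc_iff_forall_not_isModelSliceDisc` of `NoDiscNormalForm.lean`)
  obtain ⟨g, hg⟩ : ∃ g, IsModelSliceDisc 0 K' g := by
    obtain ⟨g, hg | hg⟩ :=
      Theorems.DcrGfgmw.exists_isModelSliceDisc_or_mirror_of_diffeomorph hmk.mem Θ hd
    · exact ⟨g, hg⟩
    · refine ⟨modelMirror ∘ g, ?_⟩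
      have h2 : IsModelSliceDisc 0 (modelMirror ∘ (modelMirror ∘ K')) (modelMirror ∘ g) :=
        hg.modelMirror_comp
      have hKK : modelMirror ∘ (modelMirror ∘ K') = K' := by
        funext t
        simp [Function.comp_apply]
      rwa [hKK] at h2
  -- push it into `S⁴` and un-scale
  have hS := hg.isSliceDiscInComplement_chartAt_symm
    (⟨EuclideanSpace.single 0 1, by simp⟩ : Metric.sphere (0 : EuclideanSpace ℝ (Fin 5)) 1)
  have hIn := isSliceDiscIn_of_isSliceDiscInComplement_zero hD hS
  -- Palais' complementary ball and neatening
  obtain ⟨U, c, hc₁, hc₂⟩ := Knot.palais_ballComplement_sphere_four_holds _ hIn.isSmoothEmbedding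
  obtain ⟨g', hg'⟩ := hIn.exists_isProperDisc c hc₁ hc₂
  exact Knot.isSmoothlySlice_of_isProperDisc_holds K g' hg'

/-- **Contrapositive, FGMW form**: a knot slice in a homotopy 4-ball but not in `B⁴` (the FGMW /
Manolescu–Piccirillo certificate, e.g. route `ZeroSurgeryExotic`'s waypoint) proves the crux at
`k = 0` — so refuting `DcrGap` is AT LEAST as hard as refuting the whole FGMW strategy.
[cite: FreedmanGompfMorrisonWalker2010, §1] -/
theorem not_fgmw_of_not_dcrGap (hX : ¬ DcrGap) :
    ¬ ∃ K : Knot, K.IsHomotopyBallSlice ∧ ¬ K.IsSmoothlySlice := fun ⟨K, hb, hs⟩ =>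
  hs (isSmoothlySlice_of_isHomotopyBallSlice_of_not_dcrGap hX K hb)

end Summit.SmoothPoincare4.SmoothPoincare4.Theorems.DcrGap.Negative

end
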